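import Summits.CriticalPhenomena.PercolationContinuityZ3.Theorems.PercNearOneGluingNoHeavyLowerTailJBernSunflowerKleitmanAcyclic
import HarnessLib

/-!
# `NoHeavyLowerTail` (crux stmt-CriticalPhenomena-4575), hull-port line hp-7: SUNFLOWER–KLEITMAN for three up-sets — the six TRANSITIVE W-Λ rows
# in the `Sunflower` vocabulary of prim-ineq-prove-1 / prim-l12-p2

Support file (prover `prim-hp-7`, generation 49; `--supports stmt-CriticalPhenomena-4575`).  No definitions, no `sorry`, standard axioms.
Memo: `prim-hp-7/FROM-prim-hp-7-g49-WLAMBDA-ACYCLIC.md` §6.  Corollary of `JBern.card_filter_source_le_card_filter_target` (`…JBernSunflowerKleitmanAcyclic`).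

For a sunflower of three up-sets `V 0, V 1, V 2` of `2^α` with common pairwise intersection `A` (`SunflowerPartition.Sunflower`), any "rank" `π : Fin 3 → ℕ`
of the petals and any up-set `𝒰`:
  `#{ζ ∈ 𝒰 : ζ ∈ V i ∖ A, univ∖ζ ∈ V j ∖ A for some i, j with π i < π j} ≤ #{ζ ∈ 𝒰 : ζ ∈ A, univ∖ζ ∉ V 0 ∪ V 1 ∪ V 2}`
(`JBern.sunflower_card_filter_orientedPair_le`).  With `π` injective these are the six transitively oriented W-Λ rows
`N^𝒰(X₁,Y₁) + N^𝒰(X₂,Y₂) + N^𝒰(X₃,Y₃) ≤ N^𝒰(T,PM)` of the J-BERN⁺ fibre analysis (percolation reading: `V 0 = {o~x}`, `V 1 = {o~v}`, `V 2 = {x~v}` on a fibre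
minor, `A = T`, petals `O′, E, PV`, bottom `PM`); the transitive case listed "by the larger label" with a down-set weight is prim-l12-p2's
`Sunflower.card_cross_filter_le` (p275074), proved independently.  The two cyclic orientations are not of this form and remain open. [this work]
-/

namespace Summit.CriticalPhenomena.PercolationContinuityZ3.Theorems.JBern

open Finset
open Summit.CriticalPhenomena.PercolationContinuityZ3.Theorems.SunflowerPartition

variable {α : Type*} [Fintype α] [DecidableEq α]

omit [Fintype α] in
/-- In a sunflower, a set of `V i` outside the kernel lies in no other `V j`. [this work] -/
theorem sunflower_not_mem_V_of_ne (F : Sunflower α) {x : Finset α} {i j : Fin 3} (hij : i ≠ j) (hi : x ∈ F.V i) (hA : x ∉ F.A) :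
    x ∉ F.V j := fun hj => hA (F.mem_A_of_mem_mem hij hi hj)

omit [Fintype α] in
/-- The petal rank `ρ x = π i` on `V i ∖ A` (for the if-chain encoding used below). [this work] -/
theorem sunflower_rank_eq (F : Sunflower α) (π : Fin 3 → ℕ) {x : Finset α} {i : Fin 3} (hi : x ∈ F.V i) (hA : x ∉ F.A) :
    (if x ∈ F.V 0 then π 0 else if x ∈ F.V 1 then π 1 else π 2) = π i := by
  obtain rfl | rfl | rfl : i = 0 ∨ i = 1 ∨ i = 2 := by fin_cases i <;> decide
  · rw [if_pos hi]
  · rw [if_neg (sunflower_not_mem_V_of_ne F (by decide) hi hA), if_pos hi]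
  · rw [if_neg (sunflower_not_mem_V_of_ne F (by decide) hi hA), if_neg (sunflower_not_mem_V_of_ne F (by decide) hi hA)]

/-- **Sunflower–Kleitman for three up-sets, all transitive orientations** (this work).  For a sunflower `F` of three up-sets with kernel `A`,
a petal rank `π : Fin 3 → ℕ` and an up-set `𝒰`: the antipodal pairs `(ζ, univ∖ζ)` in `𝒰` lying in two petals `i, j` with `π i < π j` are at most as
many as the kernel–bottom pairs in `𝒰`.  Instance of `card_filter_source_le_card_filter_target` with `K = A`, `D = (V 0 ∪ V 1 ∪ V 2)ᶜ`,
`ρ` = petal rank. [this work] -/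
theorem sunflower_card_filter_orientedPair_le (F : Sunflower α) (π : Fin 3 → ℕ)
    (𝒰 : Finset (Finset α)) (h𝒰 : IsUpperSet (𝒰 : Set (Finset α))) :
    #(𝒰.filter fun ζ => ∃ i j : Fin 3, π i < π j ∧ ζ ∈ F.V i ∧ ζ ∉ F.A ∧ univ \ ζ ∈ F.V j ∧ univ \ ζ ∉ F.A)
      ≤ #(𝒰.filter fun ζ => ζ ∈ F.A ∧ ∀ i : Fin 3, univ \ ζ ∉ F.V i) := by
  classical
  set K := F.A with hKdef
  set D := (univ : Finset (Finset α)).filter (fun x => ∀ i : Fin 3, x ∉ F.V i) with hDdef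
  let ρ : Finset α → ℕ := fun x => if x ∈ F.V 0 then π 0 else if x ∈ F.V 1 then π 1 else π 2
  have hmemD : ∀ x : Finset α, x ∈ D ↔ ∀ i : Fin 3, x ∉ F.V i := fun x => by
    rw [hDdef, mem_filter]; exact ⟨fun h => h.2, fun h => ⟨mem_univ _, h⟩⟩
  have hK : IsUpperSet (K : Set (Finset α)) := fun a b hab ha => by
    rw [Finset.mem_coe] at ha ⊢; exact F.mem_A_of_subset hab ha
  have hD : IsLowerSet (D : Set (Finset α)) := fun a b hba ha => by
    rw [Finset.mem_coe, hmemD] at ha ⊢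
    exact fun i hb => ha i (F.mem_V_of_subset hba hb)
  have hKD : Disjoint K D := by
    rw [Finset.disjoint_left]
    intro x hxK hxD
    rw [hmemD] at hxD
    exact hxD 0 (mem_inter.1 hxK).1
  have hρ : ∀ s t : Finset α, s ⊆ t → s ∉ D → t ∉ K → ρ s = ρ t := by
    intro s t hst hsD htK
    rw [hmemD] at hsD
    simp only [not_forall, not_not] at hsD
    obtain ⟨i, hsi⟩ := hsD
    have hti : t ∈ F.V i := F.mem_V_of_subset hst hsi
    have hsA : s ∉ F.A := fun h => htK (F.mem_A_of_subset hst h)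
    show (if s ∈ F.V 0 then π 0 else if s ∈ F.V 1 then π 1 else π 2) = (if t ∈ F.V 0 then π 0 else if t ∈ F.V 1 then π 1 else π 2)
    rw [sunflower_rank_eq F π hsi hsA, sunflower_rank_eq F π hti htK]
  have main := card_filter_source_le_card_filter_target K D ρ hK hD hKD hρ 𝒰 h𝒰
  -- identify the two filters
  have hsrc : (𝒰.filter fun ζ => ∃ i j : Fin 3, π i < π j ∧ ζ ∈ F.V i ∧ ζ ∉ F.A ∧ univ \ ζ ∈ F.V j ∧ univ \ ζ ∉ F.A)
      = 𝒰.filter (fun ζ => ζ ∉ K ∧ ζ ∉ D ∧ univ \ ζ ∉ K ∧ univ \ ζ ∉ D ∧ ρ ζ < ρ (univ \ ζ)) := by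
    refine Finset.filter_congr fun ζ _ => ?_
    constructor
    · rintro ⟨i, j, hij, hζi, hζA, hcj, hcA⟩
      refine ⟨hζA, fun h => (hmemD ζ).1 h i hζi, hcA, fun h => (hmemD _).1 h j hcj, ?_⟩
      show (if ζ ∈ F.V 0 then π 0 else if ζ ∈ F.V 1 then π 1 else π 2) < (if univ \ ζ ∈ F.V 0 then π 0 else if univ \ ζ ∈ F.V 1 then π 1 else π 2)
      rw [sunflower_rank_eq F π hζi hζA, sunflower_rank_eq F π hcj hcA]; exact hij
    · rintro ⟨hζK, hζD, hcK, hcD, hlt⟩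
      rw [hmemD] at hζD hcD
      simp only [not_forall, not_not] at hζD hcD
      obtain ⟨i, hζi⟩ := hζD
      obtain ⟨j, hcj⟩ := hcD
      refine ⟨i, j, ?_, hζi, hζK, hcj, hcK⟩
      have h1 := sunflower_rank_eq F π hζi hζK
      have h2 := sunflower_rank_eq F π hcj hcK
      change (if ζ ∈ F.V 0 then π 0 else if ζ ∈ F.V 1 then π 1 else π 2) < (if univ \ ζ ∈ F.V 0 then π 0 else if univ \ ζ ∈ F.V 1 then π 1 else π 2) at hlt
      rw [h1, h2] at hlt; exact hlt
  have htgt : (𝒰.filter fun ζ => ζ ∈ F.A ∧ ∀ i : Fin 3, univ \ ζ ∉ F.V i) = 𝒰.filter (fun ζ => ζ ∈ K ∧ univ \ ζ ∈ D) := by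
    refine Finset.filter_congr fun ζ _ => ?_
    rw [hmemD]
  rw [hsrc, htgt]
  exact main

end Summit.CriticalPhenomena.PercolationContinuityZ3.Theorems.JBern
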